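import Summits.BirchSwinnertonDyer.Rank1Residual.X11b.ClassClosureSymbolTablePeriodUnit
import HarnessLib

/-!
# Class X11b = N8 (lane CLASS-CLOSURE, seat `cc-typer-3`): the symbol-table certificate with the
# period ingredient discharged by Mazur 1978 Cor. 4.1 — f-currency twin and the class-level
# minimal-pair roads (companion of `ClassClosureSymbolTablePeriodUnit`; cell `b2b-bsdres`)

HONEST FRAMING (verbatim, cell `b2b-bsdres`, run/shared/lean/b2b/bsd-rank1-residual/): the goal of
the cell is to DELETE the COMBINATION-SHAPED residual classes for ALL analytic-rank `≤ 1` curves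
over `ℚ` — "full BSD formula for every rank `≤ 1` curve in class `C`" assembled STRICTLY from
published theorems — so that the rank-`≤ 1` remainder becomes exactly the CONSTRUCTION-SHAPED
classes, which are TYPED (missing-input Props), NOT attempted; this is not "finishing BSD".
Lane CLASS-CLOSURE: prove what is provable now; shrink each hard class to its core with data; no
claim beyond stated classes. THEOREMS ONLY (no definition, no named fact, no `sorry`); nothing
booked; no label / mark changes; certificate rows are EVIDENCE / instrumentation.

## What this file proves

`ClassClosureSymbolTablePeriodUnit` shows `‖Ω⁺_{f₀}/Ω_E‖_p = 1` at an odd multiplicative prime with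
`E[p]` irreducible from the tree named fact `mazur_not_dvd_maninConstant_of_odd` (Mazur 1978 Cor. 4.1,
via `SkinnerUrban2014.exists_unit_mul_plusPeriod_of_irreducible_of_mazur`) and derives the x-currency
unit-coefficient certificate with NO bound / inequality clause (`unitCoeffAt_of_symbolTable_of_mazur`).
Here:
* `unitCoeffAt_of_lt_pow_of_mazur` — the f-currency twin of p292196
  (`Iwasawa.unitCoeffAt_of_lt_pow_of_analyticRank_ne_zero`): per `(f, ϖ)` the datum is ONE level
  `n₀` with `p^{n₀} > k` and `‖ϖ·RS k n₀‖_p = 1` only — `‖ϖ‖_p = 1` makes the inequality clause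
  `p⁻¹ < ‖RS k n₀‖` automatic (`Iwasawa.inv_lt_norm_of_norm_mul_eq_one`);
* class level: `bsdp_of_symbolTable_of_mazur_one` (¬(ram) minimal pairs, p276240's
  `bsdp_of_unitCoeffAt_one`: X11b, `p ≥ 5`, `ρ̄` onto) and `bsdp_of_ram_of_symbolTable_of_mazur_one`
  ((ram) minimal pairs, p282302's `bsdp_of_ram_of_unitCoeffAt_one`: non-split any odd `p`, split
  `p ≥ 5`) — per-pair datum = `hx` + ONE level with `p^{n₀} > 1 + e` + ONE unit Riemann sum.

Nothing about any curve is asserted; nothing booked; X11b stays CONSTRUCTION-SHAPED; which rows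
instantiate `hx` and the certificate is the census seats' EVIDENCE; Mazur's fact is a named binder
(no `_holds` in the tree; not discharged here).

References: [Mazur1978] Cor. 4.1; [GreenbergVatsal2000] §3 Rem. 3.4; [MazurTateTeitelbaum1986Invent]
§I.4 (4.2), §I.10, §I.12–I.14; [SteinWuthrich2013] §3, §4.2, Thm. 6.1; [Wuthrich2014] Thm. 3;
[Skinner2016PacificMC] Thm. A; [Disegni2020] Thm. 1; HOME/class-closure/O2/TYPER-3.md §15.
-/

set_option autoImplicit false

noncomputable section

open scoped Classical MatrixGroups ModularForm

open CongruenceSubgroup WeierstrassCurve Literature.NumberTheory.EllipticCurves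
  Literature.NumberTheory.EllipticCurves.ModularForms
  Literature.NumberTheory.EllipticCurves.Rank1Residual
  Literature.NumberTheory.EllipticCurves.Rank1Residual.Typed
  Literature.NumberTheory.EllipticCurves.Skinner2016
  Literature.NumberTheory.EllipticCurves.SteinWuthrich2013
  Literature.NumberTheory.EllipticCurves.Wuthrich2014
  Literature.NumberTheory.EllipticCurves.Disegni2020

namespace Summit.BirchSwinnertonDyer.Rank1Residual.X11b.ClassClosure

open X11a

/-! ### §1 f-currency twin: p292196's datum with the inequality clause discharged -/

section FCurrency

variable {W : WeierstrassCurve ℚ} [W.IsElliptic] [W.IsGloballyMinimal] {p : ℕ} [Fact p.Prime]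

/-- **`Iwasawa.UnitCoeffAt W p n` in f-currency, granted Mazur's fact**: at an ODD multiplicative
prime with `E[p]` irreducible, in POSITIVE analytic rank, the per-`(f, ϖ)` datum of
`Iwasawa.unitCoeffAt_of_lt_pow_of_analyticRank_ne_zero` loses its middle clause — `‖ϖ‖_p = 1`
(`norm_ratCast_periodRatio_eq_one_of_mazur`) and `‖ϖ·RS k n₀‖ = 1` give `p⁻¹ < ‖RS k n₀‖`
(`Iwasawa.inv_lt_norm_of_norm_mul_eq_one`) — so it reads: ONE level `n₀` with `p^{n₀} > k` and
`‖ϖ·RS k n₀‖_p = 1` (`k = n` non-split, signed sums; `k = n + 1` split). Nothing booked.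
[cite: Mazur1978, Cor. 4.1] [cite: MazurTateTeitelbaum1986Invent, §I.4 (4.2), §I.10 and §I.12–I.13]
[cite: SteinWuthrich2013, §3 and §4.2] -/
theorem unitCoeffAt_of_lt_pow_of_mazur (hM : mazur_not_dvd_maninConstant_of_odd) (hp2 : p ≠ 2)
    (hmult : W.HasMultiplicativeReductionAtPrime p) (hirr : W.HasIrreducibleModPGaloisRep p)
    (hr : W.analyticRank ≠ 0) {n : ℕ}
    (h : ∀ {N : ℕ} [NeZero N] (f : CuspForm (Gamma0 N) 2), IsNewformOf W f →
      ∀ (ϖ : ℚ), (ϖ : ℝ) * W.realPeriodRat = plusPeriod f →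
        (¬ W.HasSplitMultiplicativeReductionAtPrime p →
          ∃ (n₀ : ℕ) (RS : ℕ → ℕ → ℚ_[p]),
            (∀ k m : ℕ, RS k m =
              ∑ᶠ ξ : rootsOfUnity (torsionOrder p) ℤ_[p], ∑ s : ZMod (p ^ m),
                (fun (m : ℕ) (a : ZMod (p ^ m)) ↦
                    (-1 : ℚ_[p]) ^ m * (ratPlusSymbol f ((a.val : ℚ) / (p : ℚ) ^ m) : ℚ_[p]))
                  (m + cyclotomicExponent p)
                    (PadicInt.toZModPow (m + cyclotomicExponent p) ((ξ : ℤ_[p]ˣ) : ℤ_[p]) *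
                      (cyclotomicGenerator p : ZMod (p ^ (m + cyclotomicExponent p))) ^ s.val) *
                  ((s.val.choose k : ℕ) : ℚ_[p])) ∧
            n < p ^ n₀ ∧ ‖((ϖ : ℚ) : ℚ_[p]) * RS n n₀‖ = 1) ∧
        (W.HasSplitMultiplicativeReductionAtPrime p →
          ∃ (n₀ : ℕ) (RS : ℕ → ℕ → ℚ_[p]),
            (∀ k m : ℕ, RS k m =
              ∑ᶠ ξ : rootsOfUnity (torsionOrder p) ℤ_[p], ∑ s : ZMod (p ^ m),
                (fun (m : ℕ) (a : ZMod (p ^ m)) ↦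
                    (ratPlusSymbol f ((a.val : ℚ) / (p : ℚ) ^ m) : ℚ_[p]))
                  (m + cyclotomicExponent p)
                    (PadicInt.toZModPow (m + cyclotomicExponent p) ((ξ : ℤ_[p]ˣ) : ℤ_[p]) *
                      (cyclotomicGenerator p : ZMod (p ^ (m + cyclotomicExponent p))) ^ s.val) *
                  ((s.val.choose k : ℕ) : ℚ_[p])) ∧
            n + 1 < p ^ n₀ ∧ ‖((ϖ : ℚ) : ℚ_[p]) * RS (n + 1) n₀‖ = 1)) :
    Iwasawa.UnitCoeffAt W p n := by
  apply Iwasawa.unitCoeffAt_of_lt_pow_of_analyticRank_ne_zero hp2 hmult hr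
  intro N _ f hf ϖ hϖ
  have hϖ1 : ‖((ϖ : ℚ) : ℚ_[p])‖ ≤ 1 :=
    (norm_ratCast_periodRatio_eq_one_of_mazur W p hM hp2 hmult hirr hf hϖ).le
  obtain ⟨hns, hs⟩ := h f hf ϖ hϖ
  refine ⟨fun h' ↦ ?_, fun h' ↦ ?_⟩
  · obtain ⟨n₀, RS, hRS, hk, hunit⟩ := hns h'
    exact ⟨n₀, RS, hRS, hk, Iwasawa.inv_lt_norm_of_norm_mul_eq_one hϖ1 hunit, hunit⟩
  · obtain ⟨n₀, RS, hRS, hk, hunit⟩ := hs h'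
    exact ⟨n₀, RS, hRS, hk, Iwasawa.inv_lt_norm_of_norm_mul_eq_one hϖ1 hunit, hunit⟩

end FCurrency

/-! ### §2 Class level: the N8 minimal-pair roads, period ingredient discharged -/

section ClassLevel

variable (W : WeierstrassCurve ℚ) [W.IsElliptic] [W.IsGloballyMinimal] (p : ℕ) [Fact p.Prime]

/-- **¬(ram) MINIMAL PAIR from a symbol table, period ingredient discharged** (= p276240's
`bsdp_of_unitCoeffAt_one` ∘ `unitCoeffAt_of_symbolTable_of_mazur` at index `1`): on X11b at
`p ≥ 5` with `ρ̄_{E,p}` onto, the per-pair datum is `hx` + ONE level `n₀` with `p^{n₀} > 1`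
(non-split; `‖RS 1 n₀‖_p = 1`) resp. `p^{n₀} > 2` (split; `‖RS 2 n₀‖_p = 1`); named facts:
Mazur 1978 Cor. 4.1, Kato–Wuthrich A32, Stein–Wuthrich Thm 6.1 ×2 + §4.2 ×2, Disegni 2020 Thm 1,
GZK, modularity (+ at a split `p`: a second multiplicative prime or the EVIDENCE-labelled conjecture
`RelativeExceptionalLeadingTermAt W p`). CONDITIONAL; nothing booked; X11b stays CONSTRUCTION-SHAPED.
[cite: Mazur1978, Cor. 4.1] [cite: Wuthrich2014, Thm. 3 (p. 382) and Cor. 19 proof (p. 399)]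
[cite: SteinWuthrich2013, Thm. 6.1 (p. 20), §4.2, §3] [cite: Disegni2020, Thm. 1 (§1.2), hypothesis (∗)]
[cite: MazurTateTeitelbaum1986Invent, §I.10 Prop. and §I.12–I.14] -/
theorem bsdp_of_symbolTable_of_mazur_one (hM : mazur_not_dvd_maninConstant_of_odd)
    (hKato : kato_charIdeal_dvd_multiplicative_of_surjective)
    (hJn : thm61_nonsplitMultiplicative) (hJs : thm61_splitMultiplicative)
    (hHn : exists_isMultCanonical) (hHs : exists_isSplitMultCanonical)
    (hD : thm1_padicBSD_rankOne_multiplicative)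
    (hGZK : rank_eq_analyticRank_of_analyticRank_le_one) (hpar : nonempty_modularParametrizationData)
    (hX : ClassX11b W p) (hp : 5 ≤ p) (hsurj : Surj W p)
    {N₀ : ℕ} [NeZero N₀] {f₀ : CuspForm (Gamma0 N₀) 2}
    (hf₀ : IsNewformOf W f₀) {ϖ₀ : ℚ} (hϖ₀ : (ϖ₀ : ℝ) * W.realPeriodRat = plusPeriod f₀)
    {u : ℚ} (hu : ‖((u : ℚ) : ℚ_[p])‖ = 1) {x : ℚ → ℚ}
    (hx : ∀ r : ℚ, x r = u * ϖ₀ * ratPlusSymbol f₀ r)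
    (hns : ¬ W.HasSplitMultiplicativeReductionAtPrime p →
        ∃ (n₀ : ℕ) (RS : ℕ → ℕ → ℚ_[p]),
          (∀ k m : ℕ, RS k m =
            ∑ᶠ ξ : rootsOfUnity (torsionOrder p) ℤ_[p], ∑ s : ZMod (p ^ m),
              (fun (m : ℕ) (a : ZMod (p ^ m)) ↦
                  (-1 : ℚ_[p]) ^ m * (x ((a.val : ℚ) / (p : ℚ) ^ m) : ℚ_[p]))
                (m + cyclotomicExponent p)
                  (PadicInt.toZModPow (m + cyclotomicExponent p) ((ξ : ℤ_[p]ˣ) : ℤ_[p]) *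
                    (cyclotomicGenerator p : ZMod (p ^ (m + cyclotomicExponent p))) ^ s.val) *
                ((s.val.choose k : ℕ) : ℚ_[p])) ∧
          1 < p ^ n₀ ∧ ‖RS 1 n₀‖ = 1)
    (hs : W.HasSplitMultiplicativeReductionAtPrime p →
        ∃ (n₀ : ℕ) (RS : ℕ → ℕ → ℚ_[p]),
          (∀ k m : ℕ, RS k m =
            ∑ᶠ ξ : rootsOfUnity (torsionOrder p) ℤ_[p], ∑ s : ZMod (p ^ m),
              (fun (m : ℕ) (a : ZMod (p ^ m)) ↦ (x ((a.val : ℚ) / (p : ℚ) ^ m) : ℚ_[p]))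
                (m + cyclotomicExponent p)
                  (PadicInt.toZModPow (m + cyclotomicExponent p) ((ξ : ℤ_[p]ˣ) : ℤ_[p]) *
                    (cyclotomicGenerator p : ZMod (p ^ (m + cyclotomicExponent p))) ^ s.val) *
                ((s.val.choose k : ℕ) : ℚ_[p])) ∧
          1 + 1 < p ^ n₀ ∧ ‖RS (1 + 1) n₀‖ = 1)
    (hγ : W.HasSplitMultiplicativeReductionAtPrime p →
      (∃ (m : ℕ) (_ : Fact m.Prime), m ≠ p ∧ W.HasMultiplicativeReductionAtPrime m) ∨
        RelativeExceptionalLeadingTermAt W p) :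
    BSDp W p :=
  bsdp_of_unitCoeffAt_one W p hKato hJn hJs hHn hHs hD hGZK hpar hX hp hsurj
    (unitCoeffAt_of_symbolTable_of_mazur W p hM hX.2.1 hX.2.2.1 hX.2.2.2
      (by rw [hX.1]; exact one_ne_zero) hf₀ hϖ₀ hu hx hns hs) hγ

/-- **(ram) MINIMAL PAIR from a symbol table, period ingredient discharged** (= p282302's
`bsdp_of_ram_of_unitCoeffAt_one` ∘ `unitCoeffAt_of_symbolTable_of_mazur` at index `1`): the (ram)
atom of X11b — non-split at ANY odd `p`, split at `p ≥ 5`; datum = `hx` + ONE level with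
`p^{n₀} > 1 + e` + ONE unit Riemann sum; named facts: Mazur 1978 Cor. 4.1, Skinner 2016 Thm A,
Stein–Wuthrich Thm 6.1 ×2 + §4.2 ×2, Disegni 2020 Thm 1, GZK, modularity. No regulator row, no `μ`,
no image hypothesis beyond `ClassX11b`'s irreducibility. CONDITIONAL; nothing booked; readings at
`p = 3` are the x11b3 team's, not this seat's. [cite: Mazur1978, Cor. 4.1] [cite: Skinner2016PacificMC, Thm. A]
[cite: SteinWuthrich2013, Thm. 6.1 (p. 20), §4.2, §3] [cite: Disegni2020, Thm. 1 (§1.2), hypothesis (∗)]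
[cite: MazurTateTeitelbaum1986Invent, §I.10 Prop. and §I.12–I.14] -/
theorem bsdp_of_ram_of_symbolTable_of_mazur_one (hM : mazur_not_dvd_maninConstant_of_odd)
    (hA : thmA_charIdeal_multiplicative)
    (hJn : thm61_nonsplitMultiplicative) (hJs : thm61_splitMultiplicative)
    (hHn : exists_isMultCanonical) (hHs : exists_isSplitMultCanonical)
    (hD : thm1_padicBSD_rankOne_multiplicative)
    (hGZK : rank_eq_analyticRank_of_analyticRank_le_one) (hpar : nonempty_modularParametrizationData)
    (hX : ClassX11b W p) (hram : Ram W p)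
    (hp5 : W.HasSplitMultiplicativeReductionAtPrime p → 5 ≤ p)
    {N₀ : ℕ} [NeZero N₀] {f₀ : CuspForm (Gamma0 N₀) 2}
    (hf₀ : IsNewformOf W f₀) {ϖ₀ : ℚ} (hϖ₀ : (ϖ₀ : ℝ) * W.realPeriodRat = plusPeriod f₀)
    {u : ℚ} (hu : ‖((u : ℚ) : ℚ_[p])‖ = 1) {x : ℚ → ℚ}
    (hx : ∀ r : ℚ, x r = u * ϖ₀ * ratPlusSymbol f₀ r)
    (hns : ¬ W.HasSplitMultiplicativeReductionAtPrime p →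
        ∃ (n₀ : ℕ) (RS : ℕ → ℕ → ℚ_[p]),
          (∀ k m : ℕ, RS k m =
            ∑ᶠ ξ : rootsOfUnity (torsionOrder p) ℤ_[p], ∑ s : ZMod (p ^ m),
              (fun (m : ℕ) (a : ZMod (p ^ m)) ↦
                  (-1 : ℚ_[p]) ^ m * (x ((a.val : ℚ) / (p : ℚ) ^ m) : ℚ_[p]))
                (m + cyclotomicExponent p)
                  (PadicInt.toZModPow (m + cyclotomicExponent p) ((ξ : ℤ_[p]ˣ) : ℤ_[p]) *
                    (cyclotomicGenerator p : ZMod (p ^ (m + cyclotomicExponent p))) ^ s.val) *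
                ((s.val.choose k : ℕ) : ℚ_[p])) ∧
          1 < p ^ n₀ ∧ ‖RS 1 n₀‖ = 1)
    (hs : W.HasSplitMultiplicativeReductionAtPrime p →
        ∃ (n₀ : ℕ) (RS : ℕ → ℕ → ℚ_[p]),
          (∀ k m : ℕ, RS k m =
            ∑ᶠ ξ : rootsOfUnity (torsionOrder p) ℤ_[p], ∑ s : ZMod (p ^ m),
              (fun (m : ℕ) (a : ZMod (p ^ m)) ↦ (x ((a.val : ℚ) / (p : ℚ) ^ m) : ℚ_[p]))
                (m + cyclotomicExponent p)
                  (PadicInt.toZModPow (m + cyclotomicExponent p) ((ξ : ℤ_[p]ˣ) : ℤ_[p]) *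
                    (cyclotomicGenerator p : ZMod (p ^ (m + cyclotomicExponent p))) ^ s.val) *
                ((s.val.choose k : ℕ) : ℚ_[p])) ∧
          1 + 1 < p ^ n₀ ∧ ‖RS (1 + 1) n₀‖ = 1) :
    BSDp W p :=
  bsdp_of_ram_of_unitCoeffAt_one W p hA hJn hJs hHn hHs hD hGZK hpar hX hram hp5
    (unitCoeffAt_of_symbolTable_of_mazur W p hM hX.2.1 hX.2.2.1 hX.2.2.2
      (by rw [hX.1]; exact one_ne_zero) hf₀ hϖ₀ hu hx hns hs)

end ClassLevel

end Summit.BirchSwinnertonDyer.Rank1Residual.X11b.ClassClosure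

end
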